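import Literature.AlgebraicGeometry.HodgeTheory.ProjectiveMumfordRegularityBoundSubschemes
import Literature.Algebra.Homology.LaurentCechPresentationDuality
import Literature.Algebra.Homology.LaurentCechGradedQuotientFunctoriality
import HarnessLib

/-!
# Castelnuovo's lemma for submodule sheaves `K~ ⊆ F_e~` and generation of `K̄` in degrees `≤ reg`

Mumford, *Lectures on Curves on an Algebraic Surface*, Lecture 14 (pp. 99–101): if a coherent sheaf
`𝓕` on `ℙ^r` is `m`-regular (`H^i(𝓕(m - i)) = 0`, `i > 0`) then (a) `H⁰(𝓕(n)) ⊗ H⁰(𝒪(1)) ↠ H⁰(𝓕(n+1))`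
for `n ≥ m` and (b) `H^i(𝓕(n)) = 0` for `i > 0`, `n + i ≥ m`. Applied to an IDEAL SHEAF `𝓘 = K~`
(more generally a submodule sheaf `K~ ⊆ F_e~`), (a) says that the saturation
`K̄ = ⊕_n Γ(K~(n))` (`globalSectionsEquivSat`) is generated by its elements of degree `≤ m` — the
basic link "regularity bounds the degrees of generators of the saturated ideal"
(Bayer–Mumford; Eisenbud, *Geometry of Syzygies*, §4).

The tree proves Castelnuovo's lemma for graded QUOTIENTS `F_e ⧸ K`
(`ProjectiveCastelnuovoMumfordRegularity`) and, given (a) for `K~` from some `B` on, the generation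
of `K̄` in degrees `≤ B` (`ProjectiveMumfordRegularityBoundSubschemes.sat_eq_span_of_forall_top_le`).
This file supplies Castelnuovo's lemma for the SUBMODULE sheaves `K~` themselves, by transport along
the presentation `Č_d(K) ≅ Č_d(F_{e₁} ⧸ ker φ)` of `LaurentCechPresentationDuality` (`K = im φ` for a
degree-zero `φ : F_{e₁} → F_e`), made NATURAL in the multiplication maps:

* `LaurentCech.isIso_cokernel_desc_cechMapOf` — the canonical comparison
  `Č_d(F_{e₁} ⧸ ker φ) ⟶ Č_d(im φ)` (`cokernel.desc` of `φ_L`) is an isomorphism;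
  `LaurentCech.quotSMul_comp_cokernel_desc_cechMapOf` — it commutes with `g·`;
* **`LaurentCech.isZero_homology_cech_of_regular`** — Castelnuovo (b) for `K~`;
* **`LaurentCech.top_le_iSup_range_homologyMap_smulMap_of_regular`** — Castelnuovo (a) for `K~`:
  `H⁰(Č_{n+1}(K))` is spanned by `P₁ · H⁰(Č_n(K))` for `n ≥ m`;
* **`LaurentCech.sat_eq_span_of_regular`** — **if `K~` is `m`-regular then `K̄` is generated by its
  homogeneous elements of degree `≤ m`** (`k` infinite, `r ≥ 1`, `K` graded).

## References

* [Mumford1966CurvesSurface] D. Mumford, *Lectures on Curves on an Algebraic Surface*, Annals of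
  Math. Studies 59, Princeton 1966, Lecture 14 (pp. 99–101).
* [Eisenbud2005] D. Eisenbud, *The Geometry of Syzygies*, GTM 229, Springer 2005, Thm. 4.2, Cor. 4.18.
* [Hartshorne1977] R. Hartshorne, *Algebraic Geometry*, II Ex. 5.10 (p. 125), III Ex. 5.10 (p. 231).
-/

noncomputable section

open CategoryTheory CategoryTheory.Limits Pointwise

universe u

namespace Literature.Algebra.Homology

namespace LaurentCech

open OrderedCech TopCohomology

/-! ### The canonical comparison `Č_d(F_{e₁} ⧸ ker φ) ⟶ Č_d(im φ)` and its naturality -/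

section Comparison

variable {A : Type u} [CommRing A] {r : ℕ} {J₀ J₁ : Type} [Fintype J₁] [DecidableEq J₁]
  (e₀ : J₀ → ℤ) (e₁ : J₁ → ℤ) (φ : (J₁ → P A r) →ₗ[P A r] (J₀ → P A r))

/-- `Č(ker φ) ↪ Č(F_{e₁}) —φ_L→ Č(im φ)` composes to zero (`φ_L` kills `(ker φ)_{x_s}`).
[cite: Hartshorne1977, III Thm. 5.1 (proof, p. 225)] -/
theorem inclusion_ker_comp_cechMapOf (hφ : IsDegZero e₀ e₁ φ) (d : ℤ) :
    inclusion e₁ (LinearMap.ker φ) ⊤ le_top d ≫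
      cechMapOf hφ ⊤ (LinearMap.range φ) (Submodule.map_top φ).le d = 0 :=
  (presentationSC e₀ e₁ φ hφ d).zero

/-- **The comparison `Č_d(F_{e₁} ⧸ ker φ) ⟶ Č_d(im φ)` induced by `φ_L` is an isomorphism of cochain
complexes** (degreewise: `0 → Č(ker φ) → Č(F_{e₁}) → Č(im φ) → 0` is exact).
[cite: Hartshorne1977, II Cor. 5.18 (p. 121)] [cite: Hartshorne1977, III Thm. 5.1 (proof, p. 225)] -/
theorem isIso_cokernel_desc_cechMapOf (hφ : IsDegZero e₀ e₁ φ) (d : ℤ) :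
    IsIso (cokernel.desc (inclusion e₁ (LinearMap.ker φ) ⊤ le_top d)
      (cechMapOf hφ ⊤ (LinearMap.range φ) (Submodule.map_top φ).le d)
      (inclusion_ker_comp_cechMapOf e₀ e₁ φ hφ d)) := by
  have hS := shortExact_presentationSC e₀ e₁ φ hφ d
  haveI : ∀ i, IsIso ((cokernel.desc (inclusion e₁ (LinearMap.ker φ) ⊤ le_top d)
      (cechMapOf hφ ⊤ (LinearMap.range φ) (Submodule.map_top φ).le d)
      (inclusion_ker_comp_cechMapOf e₀ e₁ φ hφ d)).f i) := by
    intro i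
    have hex : LinearMap.range ((inclusion e₁ (LinearMap.ker φ) ⊤ le_top d).f i).hom =
        LinearMap.ker ((cechMapOf hφ ⊤ (LinearMap.range φ) (Submodule.map_top φ).le d).f i).hom :=
      (hS.map_of_exact
        (HomologicalComplex.eval (ModuleCat.{u} A) (ComplexShape.up ℤ) i)).exact.moduleCat_range_eq_ker
    have hsurj : Function.Surjective
        ((cechMapOf hφ ⊤ (LinearMap.range φ) (Submodule.map_top φ).le d).f i).hom := by
      haveI := hS.epi_g
      have h : Epi (((presentationSC e₀ e₁ φ hφ d).g).f i) := inferInstance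
      exact (ModuleCat.epi_iff_surjective _).1 h
    refine (ConcreteCategory.isIso_iff_bijective _).2 ⟨?_, ?_⟩
    · rw [injective_iff_map_eq_zero]
      intro z hz
      obtain ⟨x, rfl⟩ := surjective_cokernel_π_f (inclusion e₁ (LinearMap.ker φ) ⊤ le_top d) i z
      rw [← ModuleCat.comp_apply, ← HomologicalComplex.comp_f, cokernel.π_desc] at hz
      have hx : x ∈ LinearMap.ker
          ((cechMapOf hφ ⊤ (LinearMap.range φ) (Submodule.map_top φ).le d).f i).hom := hz
      rw [← hex] at hx
      obtain ⟨y, rfl⟩ := hx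
      exact cokernel_π_f_apply_f (inclusion e₁ (LinearMap.ker φ) ⊤ le_top d) i y
    · intro z
      obtain ⟨x, rfl⟩ := hsurj z
      refine ⟨((cokernel.π (inclusion e₁ (LinearMap.ker φ) ⊤ le_top d)).f i).hom x, ?_⟩
      rw [← ModuleCat.comp_apply, ← HomologicalComplex.comp_f, cokernel.π_desc]
  exact HomologicalComplex.Hom.isIso_of_components _

/-- **The comparison commutes with multiplication by a homogeneous `g ∈ P_c`** (`quotSMul` on
`Č(F_{e₁} ⧸ ker φ)`, `smulMap` on `Č(im φ)`): `φ_L` is `L`-linear.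
[cite: Hartshorne1977, III Thm. 5.1 (proof, p. 225)] [cite: Mumford1966CurvesSurface, Lecture 14 (p. 99)] -/
theorem quotSMul_comp_cokernel_desc_cechMapOf (hφ : IsDegZero e₀ e₁ φ) {c : ℤ} (g : P A r)
    (hg : toL A r g ∈ Ldeg A r c) (d d₁ : ℤ) (hd : d + c = d₁) :
    quotSMul e₁ (LinearMap.ker φ) g hg d d₁ hd ≫
        cokernel.desc (inclusion e₁ (LinearMap.ker φ) ⊤ le_top d₁)
          (cechMapOf hφ ⊤ (LinearMap.range φ) (Submodule.map_top φ).le d₁)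
          (inclusion_ker_comp_cechMapOf e₀ e₁ φ hφ d₁) =
      cokernel.desc (inclusion e₁ (LinearMap.ker φ) ⊤ le_top d)
          (cechMapOf hφ ⊤ (LinearMap.range φ) (Submodule.map_top φ).le d)
          (inclusion_ker_comp_cechMapOf e₀ e₁ φ hφ d) ≫
        smulMap e₀ (LinearMap.range φ) g hg d d₁ hd := by
  rw [← cancel_epi (cokernel.π (inclusion e₁ (LinearMap.ker φ) ⊤ le_top d)), π_comp_quotSMul_assoc,
    cokernel.π_desc, cokernel.π_desc_assoc]
  exact smulMap_comp_cechMapOf hφ ⊤ (LinearMap.range φ) (Submodule.map_top φ).le g hg d d₁ hd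

end Comparison

/-! ### Castelnuovo's lemma for `K~` -/

section Castelnuovo

variable {k : Type u} [Field k] [Infinite k] {r : ℕ} {J : Type} [Fintype J] (e : J → ℤ)

/-- **Castelnuovo (b) for a submodule sheaf `K~ ⊆ F_e~`**: if `H^i(Č_{m-i}(K)) = 0` for all `i ≥ 1`
then `H^i(Č_n(K)) = 0` for all `i ≥ 1`, `n ≥ m - i` (`K` graded, `k` infinite).
[cite: Mumford1966CurvesSurface, Lecture 14 (pp. 99–100)] [cite: Eisenbud2005, Cor. 4.18 (p. 103)] -/
theorem isZero_homology_cech_of_regular {K : Submodule (P k r) (J → P k r)} (hK : IsGraded e K)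
    (m : ℤ) (hm : ∀ i : ℤ, 1 ≤ i → IsZero ((cech e K (m - i)).homology i)) :
    ∀ i : ℤ, 1 ≤ i → ∀ n : ℤ, m - i ≤ n → IsZero ((cech e K n).homology i) := by
  obtain ⟨N, e₁, φ, hφ, rfl⟩ := exists_presentation e hK
  intro i hi n hn
  exact (isZero_homology_quot_ker_iff e e₁ φ hφ n i).1
    (isZero_homology_quot_of_regular e₁ (hφ.isGraded_ker) m
      (fun j hj => (isZero_homology_quot_ker_iff e e₁ φ hφ _ j).2 (hm j hj)) i hi n hn)

/-- **Castelnuovo (a) for `K~`**: for an `m`-regular `K~` and `n ≥ m`, `H⁰(Č_{n+1}(K))` is spanned by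
the images of the multiplication maps `g· : H⁰(Č_n(K)) → H⁰(Č_{n+1}(K))`, `g ∈ P₁`
(`k` infinite, `r ≥ 1`, `K` graded). [cite: Mumford1966CurvesSurface, Lecture 14 (pp. 99–100)]
[cite: Eisenbud2005, Cor. 4.18 (p. 103)] -/
theorem top_le_iSup_range_homologyMap_smulMap_of_regular (hr : 1 ≤ r)
    {K : Submodule (P k r) (J → P k r)} (hK : IsGraded e K) (m : ℤ)
    (hm : ∀ i : ℤ, 1 ≤ i → IsZero ((cech e K (m - i)).homology i)) {n : ℤ} (hn : m ≤ n) :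
    (⊤ : Submodule k ((cech e K (n + 1)).homology 0)) ≤
      ⨆ (g : P k r) (hg : toL k r g ∈ Ldeg k r 1), LinearMap.range
        (HomologicalComplex.homologyMap (smulMap e K g hg n (n + 1) rfl) 0).hom := by
  obtain ⟨N, e₁, φ, hφ, rfl⟩ := exists_presentation e hK
  -- natural isomorphisms `Φ_d : Č_d(F_{e₁} ⧸ ker φ) ≅ Č_d(im φ)`
  let Φ : ∀ d : ℤ, quot e₁ (LinearMap.ker φ) d ≅ cech e (LinearMap.range φ) d := fun d => by
    haveI := isIso_cokernel_desc_cechMapOf e e₁ φ hφ d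
    exact asIso (cokernel.desc (inclusion e₁ (LinearMap.ker φ) ⊤ le_top d)
      (cechMapOf hφ ⊤ (LinearMap.range φ) (Submodule.map_top φ).le d)
      (inclusion_ker_comp_cechMapOf e e₁ φ hφ d))
  have hnat : ∀ (g : P k r) (hg : toL k r g ∈ Ldeg k r 1),
      quotSMul e₁ (LinearMap.ker φ) g hg n (n + 1) rfl ≫ (Φ (n + 1)).hom =
        (Φ n).hom ≫ smulMap e (LinearMap.range φ) g hg n (n + 1) rfl := fun g hg =>
    quotSMul_comp_cokernel_desc_cechMapOf e e₁ φ hφ g hg n (n + 1) rfl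
  let H : ∀ d : ℤ, (quot e₁ (LinearMap.ker φ) d).homology 0 ≅
      (cech e (LinearMap.range φ) d).homology 0 := fun d =>
    (HomologicalComplex.homologyFunctor (ModuleCat.{u} k) (ComplexShape.up ℤ) 0).mapIso (Φ d)
  have hm' : ∀ i : ℤ, 1 ≤ i → IsZero ((quot e₁ (LinearMap.ker φ) (m - i)).homology i) :=
    fun i hi => (isZero_homology_quot_ker_iff e e₁ φ hφ _ i).2 (hm i hi)
  have hq := top_le_iSup_range_homologyMap_quotSMul_of_regular e₁ hr (hφ.isGraded_ker) m hm' hn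
  intro x _
  have hy : (H (n + 1)).inv.hom x ∈ ⨆ (g : P k r) (hg : toL k r g ∈ Ldeg k r 1), LinearMap.range
      (HomologicalComplex.homologyMap (quotSMul e₁ (LinearMap.ker φ) g hg n (n + 1) rfl) 0).hom :=
    hq Submodule.mem_top
  have hx : x = (H (n + 1)).hom.hom ((H (n + 1)).inv.hom x) := by
    rw [← ModuleCat.comp_apply, Iso.inv_hom_id, ModuleCat.id_apply]
  rw [hx]
  refine Submodule.iSup_induction _ (motive := fun y => (H (n + 1)).hom.hom y ∈ _) hy
    (fun g y hyg => ?_) (by rw [map_zero]; exact Submodule.zero_mem _)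
    (fun y z hy' hz' => by rw [map_add]; exact Submodule.add_mem _ hy' hz')
  refine Submodule.iSup_induction _ (motive := fun y => (H (n + 1)).hom.hom y ∈ _) hyg
    (fun hg y hyg' => ?_) (by rw [map_zero]; exact Submodule.zero_mem _)
    (fun y z hy' hz' => by rw [map_add]; exact Submodule.add_mem _ hy' hz')
  obtain ⟨w, rfl⟩ := hyg'
  refine Submodule.mem_iSup_of_mem g (Submodule.mem_iSup_of_mem hg ⟨(H n).hom.hom w, ?_⟩)
  change (HomologicalComplex.homologyMap (Φ n).hom 0 ≫
      HomologicalComplex.homologyMap (smulMap e (LinearMap.range φ) g hg n (n + 1) rfl) 0).hom w =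
    (HomologicalComplex.homologyMap (quotSMul e₁ (LinearMap.ker φ) g hg n (n + 1) rfl) 0 ≫
      HomologicalComplex.homologyMap (Φ (n + 1)).hom 0).hom w
  rw [← HomologicalComplex.homologyMap_comp, ← HomologicalComplex.homologyMap_comp, hnat]

/-- **Regularity bounds the generator degrees of the saturation**: if `K~ ⊆ F_e~` is `m`-regular
(`H^i(Č_{m-i}(K)) = 0` for `i ≥ 1`) then `K̄` is generated, as a `P`-module, by its homogeneous
elements of degree `≤ m` (`k` infinite, `r ≥ 1`, `K` graded) — for an ideal sheaf `𝓘_X`: the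
saturated ideal of an `m`-regular `X` is generated in degrees `≤ m`.
[cite: Mumford1966CurvesSurface, Lecture 14 (pp. 99–101)] [cite: Eisenbud2005, Thm. 4.2 (p. 56)] -/
theorem sat_eq_span_of_regular (hr : 1 ≤ r) {K : Submodule (P k r) (J → P k r)} (hK : IsGraded e K)
    (m : ℤ) (hm : ∀ i : ℤ, 1 ≤ i → IsZero ((cech e K (m - i)).homology i)) :
    sat K = Submodule.span (P k r) {w : J → P k r | w ∈ sat K ∧ ∃ d : ℤ, d ≤ m ∧ IsHomog e d w} :=
  sat_eq_span_of_forall_top_le e hr hK m fun _ hn =>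
    top_le_iSup_range_homologyMap_smulMap_of_regular e hr hK m hm hn

end Castelnuovo

end LaurentCech

end Literature.Algebra.Homology

end
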